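import Mathlib.MeasureTheory.Integral.Bochner.Basic
import Mathlib.MeasureTheory.Measure.Haar.NormedSpace
import HarnessLib

/-!
# Why a smooth-window cap is the same at every level: the `L¹` norm of a dilated kernel is dilation-invariant

Cell `pub-fluidc` (FLUID COMPUTER; host summit `NavierStokesRegularity`, negation side, machine paradigm), prover
seat p1; companion to `FluidComputer.BandSupOvershoot` (the cap `Π ≤ ∑|K|` and its sharpness) and
`FluidComputer.HalfOctaveWindow` (the declared window family, one profile at every level BY DILATION,
`window_dilate` / `window_level`). HONEST FRAMING: low prior, high value-of-information experiment on Tao's machine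
paradigm; NOT a claim that NS blows up.

The atlas's currency caveat (RULING R33) rests on two facts: a band projector's `L^∞ → L^∞` norm is the `L¹` norm of
its convolution kernel (`BandSupOvershoot.norm_sum_kernel_smul_le` + `kernel_norm_isGreatest`), and for a SMOOTH window
read at level `n` of a `λ`-adic ladder the kernel is the level-`0` kernel DILATED, `K_n(x) = c^d K(c x)` with
`c = λⁿ` (Fourier side: `φ(ξ / c)`), whose `L¹` norm does not depend on `n`. This file types the second fact in the
continuum, in the form the cell quotes it ("L_φ ≈ 11, level-independent" vs the sharp shells' `×λ` per level —
the sharp-shell kernels are NOT dilates of one integrable kernel, which is the whole difference):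

* `integral_abs_dilate_real` — on `ℝ`: `∫ |c · K(c x)| dx = ∫ |K x| dx` for `c > 0` (any `K`; both sides are `0`
  by convention when `K` is not integrable, so no integrability hypothesis is needed).
* `integral_norm_dilate` — on a finite-dimensional real normed space `E` with an additive Haar measure (e.g. `ℝ³`
  with Lebesgue measure): `∫ ‖c^{dim E} • K(c • x)‖ = ∫ ‖K x‖` for `c > 0`, vector-valued `K`.

What is NOT here (measured in the cell, not proved): the passage from the continuum kernel to the `N³`-lattice
kernel of the run (Poisson summation / aliasing), i.e. that the DISCRETE `ℓ¹` norms p2 certified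
(`HOME/atlas/rung-next/p2-lebesgue-cert/`: 6.805 / 9.106 / 10.64 / 10.95 for the first four levels of
`lp-c2-halfoctave/v1`) approach a level-independent limit; and any bound on `∫|K|` itself for the `C²` profile.

0 sorry; axioms ⊆ {propext, Classical.choice, Quot.sound}; no named fact introduced.
-/

noncomputable section

namespace Summit.NavierStokesRegularity.FluidComputer.KernelDilation

open MeasureTheory

/-- Dilation invariance of the kernel `L¹` norm on `ℝ`: `∫ |c · K(c x)| dx = ∫ |K x| dx` for `c > 0`. -/
theorem integral_abs_dilate_real (K : ℝ → ℝ) {c : ℝ} (hc : 0 < c) :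
    ∫ x, |c * K (c * x)| = ∫ x, |K x| := by
  have h := MeasureTheory.Measure.integral_comp_mul_left (fun y => |K y|) c
  simp only [abs_mul, abs_of_pos hc]
  rw [MeasureTheory.integral_const_mul, h, abs_inv, abs_of_pos hc, smul_eq_mul, ← mul_assoc,
    mul_inv_cancel₀ hc.ne', one_mul]

variable {E : Type*} [NormedAddCommGroup E] [NormedSpace ℝ E] [MeasurableSpace E] [BorelSpace E]
  [FiniteDimensional ℝ E] (μ : Measure E) [Measure.IsAddHaarMeasure μ]
  {F : Type*} [NormedAddCommGroup F] [NormedSpace ℝ F]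

/-- Dilation invariance of the kernel `L¹` norm in dimension `d = dim E` (e.g. `ℝ³`): the level-`n` kernel
`K_n(x) = c^d • K(c • x)`, `c = λⁿ > 0`, has `∫ ‖K_n‖ = ∫ ‖K‖` — the continuum reason a smooth window's
`L^∞ → L^∞` cap is the same at every level of the ladder. -/
theorem integral_norm_dilate (K : E → F) {c : ℝ} (hc : 0 < c) :
    ∫ x, ‖(c ^ Module.finrank ℝ E) • K (c • x)‖ ∂μ = ∫ x, ‖K x‖ ∂μ := by
  have h := MeasureTheory.Measure.integral_comp_smul μ (fun y => ‖K y‖) c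
  have hcd : 0 < c ^ Module.finrank ℝ E := pow_pos hc _
  simp only [norm_smul, Real.norm_eq_abs, abs_of_pos hcd]
  rw [MeasureTheory.integral_const_mul, h, abs_inv, abs_of_pos hcd, smul_eq_mul, ← mul_assoc,
    mul_inv_cancel₀ hcd.ne', one_mul]

/-- The same with the dilation factor written as `(λ^n)^d` for a `λ`-adic ladder, `λ > 0`. -/
theorem integral_norm_dilate_level (K : E → F) {lam : ℝ} (hlam : 0 < lam) (n : ℕ) :
    ∫ x, ‖((lam ^ n) ^ Module.finrank ℝ E) • K ((lam ^ n) • x)‖ ∂μ = ∫ x, ‖K x‖ ∂μ :=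
  integral_norm_dilate μ K (pow_pos hlam n)

end Summit.NavierStokesRegularity.FluidComputer.KernelDilation

end
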